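import Summits.Ventures.YMGap.FlowData.RitzDeflationCertificate

/-!
# Venture YMGap, track Y3 FLOW-DATA — the K-WEIGHT TAIL THEOREM (TAIL-A) AT OPERATOR LEVEL, level 0 (file 1/2):
# `σ ≤ ‖T‖ ≤ μ + κ‖A‖²` from a Rayleigh witness / a PSD test on the KEPT GALERKIN BLOCK, for a bounded symmetric `T`
# on a (possibly infinite-dimensional) real inner-product space

HONEST FRAMING: venture file of the cell `pub-ymgap` (QuantumFields programme), track Y3, lineage A (seat flow-eng-1).
Abstract operator theory on a real inner-product space plus finite real linear algebra; NO lattice object, no number,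
no row, nothing about limits or a mass gap.

WHY.  The kept-set tail theorem of the Y3 transfer-matrix lineages (`FlowData/KWeightTailTheorem`, flow-ref FR-18 =
TAIL-A: `λ↓_k(S_T) ≤ λ↓_k(S) ≤ λ↓_k(S_T) + κ_T·Ω` for `S = K^{1/2} V K^{1/2}` and its kept-set compression `S_T`) is
typed as FINITE-dimensional linear algebra: a finite index type STANDS FOR the infinite spin-network basis — the cell's
finite-cross-section modelling convention (lineage A's `TYPED-CHAIN-A.md`, «what stays an input» (iv)).  Meanwhile the
cell's OBJECT is typed as a genuine operator: `tubeTransferOperator` / `rectTubeTransferOperator` is a compact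
self-adjoint positive operator on `L²(SU(2)^{links})`, and EVERY typed table quantity is a LEVEL-0 quantity of it —
an operator norm `‖T‖` (`λ̂₀`), `‖T ∘ P_e‖` (`λ̂₀^{(e)}`: `TorelonEnergy.sectorNorm`, `TubeSectorEigenvalue`),
`‖T ∘ (P_0 − P_Ω)‖` (`RectTubeExcitedEigenvalue`), or a difference of their logarithms (`E₁`, `E₂`, `m′`).  This file
is TAIL-A for such level-0 quantities WITHOUT any finite-dimensionality: for a bounded symmetric operator `T` on a real
inner-product space `E` whose quadratic form FACTORS through a positive operator `𝒦` on a second space `F`,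

  `⟪x, T x⟫ = ⟪A x, 𝒦 (A x)⟫`  (`A : E →L F`; for the tube: `A` = multiplication by the half spatial weight
  `e^{J·mag/2}`, `𝒦` = the temporal-plaquette / Gauss-law kernel operator, `T = A 𝒦 A`),

with `𝒦` DIAGONAL on a finite orthonormal KEPT family `f_i` (`𝒦 f_i = q_i f_i`: the kept spin networks, `q_i` = the
product of their link weights) and SMALL on the orthocomplement of their span (`⟪z, 𝒦 z⟫ ≤ κ‖z‖²` whenever `z ⊥ f_i`
for all `i`: the dropped kinetic weights are `≤ κ = κ_T`), and with `g_i := A† f_i` given adjoint-free through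
`⟪g_i, x⟫ = ⟪f_i, A x⟫` and the KEPT GALERKIN BLOCK `G_ij = √q_i √q_j ⟪g_i, g_j⟫` (for the tube
`⟪g_i, g_j⟫ = ∫ e^{J·mag} f_i f_j` = `GalerkinWeightMonotone.weightMatrix` of the full spatial weight, i.e. `G` is the
engine's block `K_T^{1/2} V K_T^{1/2}` of ENGINE.md §3 (i), and `‖A‖² = sup e^{J·mag} = Ω`):

* **`norm_le_of_galerkin_bound`** — if `cᵀ G c ≤ μ cᵀ c` for all `c` (`μ·1 − G ⪰ 0`, what a deflation / Cholesky
  certificate delivers, `μ ≥ 0`) then `‖T‖ ≤ μ + κ ‖A‖²`;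
* **`le_norm_of_galerkin_witness`** — if `σ cᵀ c ≤ cᵀ G c` for some `c ≠ 0` (a Ritz value `≥ σ`) then `σ ≤ ‖T‖`
  (neither the symmetry of `T` nor the dropped bound is needed for this half).

File 2/2 (`KWeightTailOperatorBlock`) turns these into `λ↓₀(G) ≤ ‖T‖ ≤ λ↓₀(G) + κ‖A‖²` for Mathlib's
`Matrix.IsHermitian.eigenvalues₀` of `G` (the interface of `RitzDeflation.block_enclosure`), the sector version
`‖T ∘ Q‖` and the row arithmetic of `E_e = log ‖T‖ − log ‖T ∘ P_e‖`.

PROOF (square-root free).  Split `y = A x` into its kept part `y_T = Σ_i ⟪f_i, y⟫ f_i` and `y − y_T ⊥ f_i`; since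
`𝒦 y_T ∈ span f_i` and `𝒦` is symmetric the cross terms vanish:
`⟪y, 𝒦 y⟫ = Σ_i q_i ⟪f_i, y⟫² + ⟪y − y_T, 𝒦 (y − y_T)⟫` (`inner_kinetic_eq`), the last term in `[0, κ‖y‖²]`
(`sum_le_inner_kinetic`, `inner_kinetic_le_sum_add`; Bessel `norm_sub_keptPart_sq`).  The kept term is `‖Z† x‖²` for
`Z c = Σ_i c_i √q_i g_i` (`ℝ^ι → E`, `Z† Z = G`: `norm_sq_trial`, `keptCoeff_trial`): it is `≤ μ‖x‖²` by Cauchy–Schwarz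
against `Z Z† x` (`keptForm_le` — `‖Z Z†‖ ≤ ‖Z† Z‖` without adjoints) and `≥ ‖G c‖²` at the trial vector `x = Z c`;
finally `‖T‖ = sup |⟪T x, x⟫|/‖x‖²` for symmetric `T` (Mathlib `ContinuousLinearMap.norm_eq_iSup_rayleighQuotient`;
`norm_le_of_forall_inner_le`) and `⟪T x, x⟫ ≤ ‖T‖‖x‖²`.  Everything is stated for an arbitrary matrix `G` with the
entry hypothesis `hG`, so a consumer's block defined otherwise but entrywise equal is served; no definition is made.

WHAT IS NOT HERE: levels `k ≥ 1` (the `m`, `m″` rows: `λ̂₁^{A₁}` is not a level-0 quantity of a projection commuting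
with `A` and `𝒦`); the IDENTIFICATION for the tube (that `⟪x, T x⟫ = ⟪e^{J mag/2} x, 𝒦 (e^{J mag/2} x)⟫` with `𝒦`
diagonal on spin networks with eigenvalues `Π_links c_ν/(ν+1)` — the character calculus of `LinkWeightExpansion` /
`LinkCharacterBessel` — and that the orthocomplement of the kept networks has kinetic form `≤ κ_T`, the gauge-variant
functions being killed by the Gauss-law projection inside `𝒦`); the numbers.  Given that identification, a certified
lineage-A/B enclosure `[lo, hi]` of `λ↓₀` of a kept block reads `lo ≤ ‖T̂ ∘ P‖ ≤ hi + κ_T Ω` for the TYPED operator,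
with no finite-basis convention.

References: R. A. Horn, C. R. Johnson, *Matrix Analysis*, 2nd ed. (2013), Thm. 4.2.2 (Rayleigh quotient), Thm. 1.3.22
(`AB` vs `BA`), Thm. 4.3.1 (Weyl) [cite: HornJohnson2013, Thm 4.2.2; Thm 1.3.22; Thm 4.3.1]; the norm of a symmetric
operator as the supremum of its Rayleigh quotient is Mathlib's `ContinuousLinearMap.norm_eq_iSup_rayleighQuotient`; the
cell's FLOW-REFEREE.md FR-18 and HOME/pub-ymgap-flow-eng-1/ENGINE.md §3 (i) (2026-08-22/25).
-/

noncomputable section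

open scoped InnerProductSpace BigOperators
open Matrix Finset WithLp

namespace Summit.Ventures.YMGap.FlowData

namespace KWeightTailOperator

open Literature.Analysis.InnerProduct

/-! ### §1 The kept / dropped splitting of the kinetic form -/

section Kinetic

variable {F : Type*} [NormedAddCommGroup F] [InnerProductSpace ℝ F] {ι : Type*} [Fintype ι]
  {f : ι → F} (𝒦 : F →L[ℝ] F) {q : ι → ℝ}

omit 𝒦 in
/-- The kept part `y_T = Σ_j ⟪f_j, y⟫ f_j` has the same coefficients as `y` on the orthonormal kept family.
[folklore] -/
theorem inner_keptPart (hf : Orthonormal ℝ f) (y : F) (i : ι) :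
    ⟪f i, ∑ j, ⟪f j, y⟫_ℝ • f j⟫_ℝ = ⟪f i, y⟫_ℝ :=
  hf.inner_right_fintype _ i

omit 𝒦 in
/-- `y − y_T` is orthogonal to every kept vector. [folklore] -/
theorem inner_sub_keptPart (hf : Orthonormal ℝ f) (y : F) (i : ι) :
    ⟪f i, y - ∑ j, ⟪f j, y⟫_ℝ • f j⟫_ℝ = 0 := by
  rw [inner_sub_right, inner_keptPart hf, sub_self]

/-- `𝒦` maps the kept part into the kept span: `𝒦 y_T = Σ_j (⟪f_j, y⟫ q_j) f_j` when `𝒦 f_j = q_j f_j`. [folklore] -/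
theorem kinetic_keptPart (hq : ∀ i, 𝒦 (f i) = q i • f i) (y : F) :
    𝒦 (∑ j, ⟪f j, y⟫_ℝ • f j) = ∑ j, (⟪f j, y⟫_ℝ * q j) • f j := by
  rw [map_sum]
  refine Finset.sum_congr rfl fun j _ => ?_
  rw [map_smul, hq j, smul_smul]

/-- A vector orthogonal to the kept family is orthogonal to `𝒦 y_T`. [folklore] -/
theorem inner_kinetic_keptPart_eq_zero (hq : ∀ i, 𝒦 (f i) = q i • f i) (y : F) {z : F}
    (hz : ∀ i, ⟪f i, z⟫_ℝ = 0) : ⟪z, 𝒦 (∑ j, ⟪f j, y⟫_ℝ • f j)⟫_ℝ = 0 := by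
  rw [kinetic_keptPart 𝒦 hq, inner_sum]
  refine Finset.sum_eq_zero fun j _ => ?_
  rw [real_inner_smul_right, real_inner_comm (f j) z, hz j, mul_zero]

/-- The kinetic form of the kept part: `⟪y_T, 𝒦 y_T⟫ = Σ_i q_i ⟪f_i, y⟫²`. [folklore] -/
theorem inner_keptPart_kinetic_keptPart (hf : Orthonormal ℝ f) (hq : ∀ i, 𝒦 (f i) = q i • f i) (y : F) :
    ⟪∑ j, ⟪f j, y⟫_ℝ • f j, 𝒦 (∑ j, ⟪f j, y⟫_ℝ • f j)⟫_ℝ = ∑ i, q i * ⟪f i, y⟫_ℝ ^ 2 := by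
  rw [kinetic_keptPart 𝒦 hq, inner_sum]
  refine Finset.sum_congr rfl fun i _ => ?_
  rw [real_inner_smul_right, hf.inner_left_fintype]
  simp only [RCLike.conj_to_real]
  ring

/-- **The kept / dropped splitting.** For a symmetric `𝒦` diagonal on the orthonormal kept family,
`⟪y, 𝒦 y⟫ = Σ_i q_i ⟪f_i, y⟫² + ⟪y − y_T, 𝒦 (y − y_T)⟫` — the cross terms vanish because `𝒦 y_T` lies in the kept
span and `y − y_T` is orthogonal to it (operator form of `K = K_T ⊕ K_⊥` in `KWeightTailTheorem`). [folklore] -/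
theorem inner_kinetic_eq (h𝒦 : (𝒦 : F →ₗ[ℝ] F).IsSymmetric) (hf : Orthonormal ℝ f)
    (hq : ∀ i, 𝒦 (f i) = q i • f i) (y : F) :
    ⟪y, 𝒦 y⟫_ℝ = (∑ i, q i * ⟪f i, y⟫_ℝ ^ 2) +
      ⟪y - ∑ j, ⟪f j, y⟫_ℝ • f j, 𝒦 (y - ∑ j, ⟪f j, y⟫_ℝ • f j)⟫_ℝ := by
  set yT : F := ∑ j, ⟪f j, y⟫_ℝ • f j with hyT
  have hz : ∀ i, ⟪f i, y - yT⟫_ℝ = 0 := inner_sub_keptPart hf y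
  have h1 : ⟪y - yT, 𝒦 yT⟫_ℝ = 0 := inner_kinetic_keptPart_eq_zero 𝒦 hq y hz
  have h2 : ⟪yT, 𝒦 (y - yT)⟫_ℝ = 0 := by
    have h := h𝒦 yT (y - yT)
    simp only [ContinuousLinearMap.coe_coe] at h
    rw [← h, real_inner_comm (y - yT) (𝒦 yT), h1]
  have hy : y = yT + (y - yT) := by abel
  conv_lhs => rw [hy]
  rw [map_add, inner_add_left, inner_add_right, inner_add_right, h1, h2,
    inner_keptPart_kinetic_keptPart 𝒦 hf hq y, add_zero, zero_add]

omit [Fintype ι] in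
/-- The kept weights are non-negative for a positive `𝒦`: `q_i = ⟪f_i, 𝒦 f_i⟫ ≥ 0`. [folklore] -/
theorem kept_weight_nonneg (h𝒦 : 𝒦.IsPositive) (hf : Orthonormal ℝ f) (hq : ∀ i, 𝒦 (f i) = q i • f i)
    (i : ι) : 0 ≤ q i := by
  have h := h𝒦.inner_nonneg_right (f i)
  rw [hq i, real_inner_smul_right, real_inner_self_eq_norm_sq, hf.1 i, one_pow, mul_one] at h
  exact h

omit 𝒦 in
/-- Pythagoras for the kept part: `‖y − y_T‖² = ‖y‖² − Σ_i ⟪f_i, y⟫²` (Bessel's equality on a finite orthonormal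
family). [folklore] -/
theorem norm_sub_keptPart_sq (hf : Orthonormal ℝ f) (y : F) :
    ‖y - ∑ j, ⟪f j, y⟫_ℝ • f j‖ ^ 2 = ‖y‖ ^ 2 - ∑ i, ⟪f i, y⟫_ℝ ^ 2 := by
  have hyy : ⟪y, ∑ j, ⟪f j, y⟫_ℝ • f j⟫_ℝ = ∑ i, ⟪f i, y⟫_ℝ ^ 2 := by
    rw [inner_sum]
    refine Finset.sum_congr rfl fun i _ => ?_
    rw [real_inner_smul_right, real_inner_comm (f i) y, sq]
  have hTT : ⟪∑ j, ⟪f j, y⟫_ℝ • f j, ∑ j, ⟪f j, y⟫_ℝ • f j⟫_ℝ = ∑ i, ⟪f i, y⟫_ℝ ^ 2 := by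
    rw [sum_inner]
    refine Finset.sum_congr rfl fun i _ => ?_
    rw [real_inner_smul_left, inner_keptPart hf, sq]
  rw [norm_sub_sq_real, hyy, ← real_inner_self_eq_norm_sq (∑ j, ⟪f j, y⟫_ℝ • f j), hTT]
  ring

/-- **TAIL-A lower half, form level**: the kept form never exceeds the full one, `Σ_i q_i ⟪f_i, y⟫² ≤ ⟪y, 𝒦 y⟫`
(`𝒦 ⪰ 0`). [folklore] -/
theorem sum_le_inner_kinetic (h𝒦 : 𝒦.IsPositive) (hf : Orthonormal ℝ f) (hq : ∀ i, 𝒦 (f i) = q i • f i)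
    (y : F) : ∑ i, q i * ⟪f i, y⟫_ℝ ^ 2 ≤ ⟪y, 𝒦 y⟫_ℝ := by
  rw [inner_kinetic_eq 𝒦 h𝒦.isSymmetric hf hq y]
  exact le_add_of_nonneg_right (h𝒦.inner_nonneg_right _)

/-- **TAIL-A upper half, form level**: if the dropped kinetic weights are at most `κ ≥ 0` — `⟪z, 𝒦 z⟫ ≤ κ‖z‖²` for every
`z` orthogonal to the kept family — then `⟪y, 𝒦 y⟫ ≤ Σ_i q_i ⟪f_i, y⟫² + κ‖y‖²`. [folklore] -/
theorem inner_kinetic_le_sum_add (h𝒦 : 𝒦.IsPositive) (hf : Orthonormal ℝ f) (hq : ∀ i, 𝒦 (f i) = q i • f i)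
    {κ : ℝ} (hκ0 : 0 ≤ κ) (hκ : ∀ z : F, (∀ i, ⟪f i, z⟫_ℝ = 0) → ⟪z, 𝒦 z⟫_ℝ ≤ κ * ‖z‖ ^ 2) (y : F) :
    ⟪y, 𝒦 y⟫_ℝ ≤ (∑ i, q i * ⟪f i, y⟫_ℝ ^ 2) + κ * ‖y‖ ^ 2 := by
  rw [inner_kinetic_eq 𝒦 h𝒦.isSymmetric hf hq y]
  have hdrop := hκ _ (inner_sub_keptPart hf y)
  have hle : ‖y - ∑ j, ⟪f j, y⟫_ℝ • f j‖ ^ 2 ≤ ‖y‖ ^ 2 := by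
    rw [norm_sub_keptPart_sq hf y]
    linarith [Finset.sum_nonneg fun i (_ : i ∈ (Finset.univ : Finset ι)) => sq_nonneg ⟪f i, y⟫_ℝ]
  have := mul_le_mul_of_nonneg_left hle hκ0
  linarith

end Kinetic

/-! ### §2 Galerkin coordinates: the kept form at `A x` through `g_i = A† f_i` and `G = (√q_i √q_j ⟪g_i, g_j⟫)` -/

section Galerkin

variable {E F : Type*} [NormedAddCommGroup E] [InnerProductSpace ℝ E] [NormedAddCommGroup F]
  [InnerProductSpace ℝ F] {ι : Type*} [Fintype ι]
  {A : E →L[ℝ] F} {f : ι → F} {q : ι → ℝ} {g : ι → E} {G : Matrix ι ι ℝ}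

/-- The trial vector `Z c = Σ_i (c_i √q_i) g_i` has `‖Z c‖² = cᵀ G c` (`Z† Z = G`). [folklore] -/
theorem norm_sq_trial (hG : ∀ i j, G i j = √(q i) * √(q j) * ⟪g i, g j⟫_ℝ) (c : ι → ℝ) :
    ‖∑ i, (c i * √(q i)) • g i‖ ^ 2 = c ⬝ᵥ (G *ᵥ c) := by
  rw [← real_inner_self_eq_norm_sq, sum_inner]
  simp only [inner_sum, real_inner_smul_left, real_inner_smul_right, dotProduct, mulVec, hG,
    Finset.mul_sum]
  refine Finset.sum_congr rfl fun i _ => Finset.sum_congr rfl fun j _ => ?_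
  ring

/-- `⟪Z c, x⟫ = Σ_i c_i √q_i ⟪f_i, A x⟫` (`= cᵀ (Z† x)`). [folklore] -/
theorem inner_trial_eq (hg : ∀ i x, ⟪g i, x⟫_ℝ = ⟪f i, A x⟫_ℝ) (c : ι → ℝ) (x : E) :
    ⟪∑ i, (c i * √(q i)) • g i, x⟫_ℝ = ∑ i, c i * (√(q i) * ⟪f i, A x⟫_ℝ) := by
  rw [sum_inner]
  refine Finset.sum_congr rfl fun i _ => ?_
  rw [real_inner_smul_left, hg, mul_assoc]

/-- `Z† Z c = G c`: the kept coefficient of `A (Z c)` is `√q_i ⟪f_i, A (Z c)⟫ = (G c)_i`. [folklore] -/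
theorem keptCoeff_trial (hg : ∀ i x, ⟪g i, x⟫_ℝ = ⟪f i, A x⟫_ℝ)
    (hG : ∀ i j, G i j = √(q i) * √(q j) * ⟪g i, g j⟫_ℝ) (c : ι → ℝ) (i : ι) :
    √(q i) * ⟪f i, A (∑ j, (c j * √(q j)) • g j)⟫_ℝ = (G *ᵥ c) i := by
  rw [← hg, inner_sum, Finset.mul_sum]
  simp only [mulVec, dotProduct, hG, real_inner_smul_right]
  refine Finset.sum_congr rfl fun j _ => ?_
  ring

/-- The kept form at `A x` in Galerkin coordinates: `Σ_i q_i ⟪f_i, A x⟫² = Σ_i (√q_i ⟪f_i, A x⟫)²` (`q_i ≥ 0`).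
[folklore] -/
theorem keptForm_eq_sum_sq (hq0 : ∀ i, 0 ≤ q i) (x : E) :
    ∑ i, q i * ⟪f i, A x⟫_ℝ ^ 2 = ∑ i, (√(q i) * ⟪f i, A x⟫_ℝ) ^ 2 := by
  refine Finset.sum_congr rfl fun i _ => ?_
  rw [mul_pow, Real.sq_sqrt (hq0 i)]

/-- **`‖Z Z†‖ ≤ ‖Z† Z‖` without adjoints.** If `cᵀ G c ≤ μ cᵀ c` for every coefficient vector (`λ_max(G) ≤ μ`, `μ ≥ 0`),
then `Σ_i q_i ⟪f_i, A x⟫² ≤ μ ‖x‖²` for every `x`: with `c = Z† x` one has `Σ = cᵀc = ⟪Z c, x⟫ ≤ ‖Z c‖‖x‖` and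
`‖Z c‖² = cᵀGc ≤ μ cᵀc`. [cite: HornJohnson2013, Thm 1.3.22] -/
theorem keptForm_le (hq0 : ∀ i, 0 ≤ q i) (hg : ∀ i x, ⟪g i, x⟫_ℝ = ⟪f i, A x⟫_ℝ)
    (hG : ∀ i j, G i j = √(q i) * √(q j) * ⟪g i, g j⟫_ℝ) {μ : ℝ} (hμ0 : 0 ≤ μ)
    (hμ : ∀ c : ι → ℝ, c ⬝ᵥ (G *ᵥ c) ≤ μ * (c ⬝ᵥ c)) (x : E) :
    ∑ i, q i * ⟪f i, A x⟫_ℝ ^ 2 ≤ μ * ‖x‖ ^ 2 := by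
  set c : ι → ℝ := fun i => √(q i) * ⟪f i, A x⟫_ℝ with hc
  set S : ℝ := ∑ i, q i * ⟪f i, A x⟫_ℝ ^ 2 with hS
  have hSc : S = c ⬝ᵥ c := by
    rw [hS, keptForm_eq_sum_sq hq0 x, dotProduct]
    exact Finset.sum_congr rfl fun i _ => sq (c i)
  have hS0 : 0 ≤ S := by
    rw [hSc, dotProduct]
    exact Finset.sum_nonneg fun i _ => mul_self_nonneg (c i)
  -- the trial vector `z = Z c`
  set z : E := ∑ i, (c i * √(q i)) • g i with hz
  have hzx : ⟪z, x⟫_ℝ = S := by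
    rw [hz, inner_trial_eq hg c x, hSc, dotProduct]
  have hzz : ‖z‖ ^ 2 ≤ μ * S := by
    rw [hz, norm_sq_trial hG c, hSc]
    exact hμ c
  have hcs : S ≤ ‖z‖ * ‖x‖ := by
    rw [← hzx]
    exact real_inner_le_norm z x
  -- `S² ≤ ‖z‖² ‖x‖² ≤ μ S ‖x‖²`
  have hsq : S * S ≤ μ * ‖x‖ ^ 2 * S := by
    calc S * S ≤ (‖z‖ * ‖x‖) * (‖z‖ * ‖x‖) := mul_self_le_mul_self hS0 hcs
      _ = ‖z‖ ^ 2 * ‖x‖ ^ 2 := by ring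
      _ ≤ (μ * S) * ‖x‖ ^ 2 := mul_le_mul_of_nonneg_right hzz (sq_nonneg _)
      _ = μ * ‖x‖ ^ 2 * S := by ring
  rcases hS0.lt_or_eq with hpos | hzero
  · exact le_of_mul_le_mul_right hsq hpos
  · rw [← hzero]
    positivity

end Galerkin

/-! ### §3 Certificate forms: `‖T‖` from a PSD test / a Rayleigh witness on the kept Galerkin block -/

section Certificate

variable {E F : Type*} [NormedAddCommGroup E] [InnerProductSpace ℝ E] [NormedAddCommGroup F]
  [InnerProductSpace ℝ F] {ι : Type*} [Fintype ι]
  {T : E →L[ℝ] E} {A : E →L[ℝ] F} {𝒦 : F →L[ℝ] F} {f : ι → F} {q : ι → ℝ} {g : ι → E} {G : Matrix ι ι ℝ}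

omit [Fintype ι] in
/-- For a factorising form, `⟪T x, x⟫ = ⟪A x, 𝒦 (A x)⟫ ≥ 0` when `𝒦 ⪰ 0`. [folklore] -/
theorem inner_apply_nonneg (h𝒦 : 𝒦.IsPositive) (hT : ∀ x, ⟪x, T x⟫_ℝ = ⟪A x, 𝒦 (A x)⟫_ℝ) (x : E) :
    0 ≤ ⟪T x, x⟫_ℝ := by
  rw [real_inner_comm, hT]
  exact h𝒦.inner_nonneg_right _

omit [Fintype ι] in
/-- The Rayleigh quotient bounds the norm from below: `⟪T x, x⟫ ≤ ‖T‖ ‖x‖²`. [cite: HornJohnson2013, Thm 4.2.2] -/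
theorem inner_apply_le_norm_mul_sq (x : E) : ⟪T x, x⟫_ℝ ≤ ‖T‖ * ‖x‖ ^ 2 := by
  calc ⟪T x, x⟫_ℝ ≤ ‖T x‖ * ‖x‖ := real_inner_le_norm _ _
    _ ≤ (‖T‖ * ‖x‖) * ‖x‖ := mul_le_mul_of_nonneg_right (T.le_opNorm x) (norm_nonneg _)
    _ = ‖T‖ * ‖x‖ ^ 2 := by ring

omit [Fintype ι] in
/-- For a SYMMETRIC operator with non-negative form, a uniform bound `⟪T x, x⟫ ≤ M‖x‖²` (`M ≥ 0`) gives `‖T‖ ≤ M`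
(`‖T‖ = sup |⟪T x, x⟫|/‖x‖²`, Mathlib `ContinuousLinearMap.norm_eq_iSup_rayleighQuotient`). [folklore] -/
theorem norm_le_of_forall_inner_le (hTsym : (T : E →ₗ[ℝ] E).IsSymmetric) (hpos : ∀ x, 0 ≤ ⟪T x, x⟫_ℝ)
    {M : ℝ} (hM0 : 0 ≤ M) (hM : ∀ x, ⟪T x, x⟫_ℝ ≤ M * ‖x‖ ^ 2) : ‖T‖ ≤ M := by
  rw [T.norm_eq_iSup_rayleighQuotient hTsym]
  refine ciSup_le fun x => ?_
  rw [ContinuousLinearMap.rayleighQuotient, ContinuousLinearMap.reApplyInnerSelf_apply, RCLike.re_to_real]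
  by_cases hx : x = 0
  · simp [hx, hM0]
  · have hx2 : 0 < ‖x‖ ^ 2 := by positivity
    rw [abs_of_nonneg (div_nonneg (hpos x) hx2.le), div_le_iff₀ hx2]
    exact hM x

/-- **TAIL-A at operator level, UPPER half, certificate form.** Let `T` be symmetric with `⟪x, T x⟫ = ⟪A x, 𝒦 (A x)⟫`,
`𝒦 ⪰ 0` diagonal on the orthonormal kept family (`𝒦 f_i = q_i f_i`) with dropped weights `≤ κ`
(`⟪z, 𝒦 z⟫ ≤ κ‖z‖²` for `z ⊥` every `f_i`), `⟪g_i, ·⟫ = ⟪f_i, A ·⟫`, `G_ij = √q_i √q_j ⟪g_i, g_j⟫`.  If the kept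
Galerkin block passes the test `cᵀ G c ≤ μ cᵀ c` for all `c` (i.e. `μ·1 − G ⪰ 0`, `μ ≥ 0`), then
`‖T‖ ≤ μ + κ ‖A‖²`. [cite: HornJohnson2013, Thm 4.3.1] -/
theorem norm_le_of_galerkin_bound (hTsym : (T : E →ₗ[ℝ] E).IsSymmetric)
    (hT : ∀ x, ⟪x, T x⟫_ℝ = ⟪A x, 𝒦 (A x)⟫_ℝ) (h𝒦 : 𝒦.IsPositive)
    (hf : Orthonormal ℝ f) (hq : ∀ i, 𝒦 (f i) = q i • f i)
    {κ : ℝ} (hκ0 : 0 ≤ κ) (hκ : ∀ z : F, (∀ i, ⟪f i, z⟫_ℝ = 0) → ⟪z, 𝒦 z⟫_ℝ ≤ κ * ‖z‖ ^ 2)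
    (hg : ∀ i x, ⟪g i, x⟫_ℝ = ⟪f i, A x⟫_ℝ) (hG : ∀ i j, G i j = √(q i) * √(q j) * ⟪g i, g j⟫_ℝ)
    {μ : ℝ} (hμ0 : 0 ≤ μ) (hμ : ∀ c : ι → ℝ, c ⬝ᵥ (G *ᵥ c) ≤ μ * (c ⬝ᵥ c)) :
    ‖T‖ ≤ μ + κ * ‖A‖ ^ 2 := by
  have hq0 : ∀ i, 0 ≤ q i := kept_weight_nonneg 𝒦 h𝒦 hf hq
  refine norm_le_of_forall_inner_le hTsym (inner_apply_nonneg h𝒦 hT) (by positivity) fun x => ?_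
  rw [real_inner_comm, hT]
  have h1 := inner_kinetic_le_sum_add 𝒦 h𝒦 hf hq hκ0 hκ (A x)
  have h2 := keptForm_le hq0 hg hG hμ0 hμ x
  have h3 : ‖A x‖ ^ 2 ≤ ‖A‖ ^ 2 * ‖x‖ ^ 2 := by
    rw [← mul_pow]
    exact pow_le_pow_left₀ (norm_nonneg _) (A.le_opNorm x) 2
  have h4 := mul_le_mul_of_nonneg_left h3 hκ0
  linarith

/-- **TAIL-A at operator level, LOWER half, certificate form (Rayleigh–Ritz).**  With `⟪x, T x⟫ = ⟪A x, 𝒦 (A x)⟫`,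
`𝒦 ⪰ 0` diagonal on the orthonormal kept family, `⟪g_i, ·⟫ = ⟪f_i, A ·⟫` and `G_ij = √q_i √q_j ⟪g_i, g_j⟫`: a coefficient
vector `c ≠ 0` with `σ cᵀc ≤ cᵀ G c` (a Ritz value of the kept block `≥ σ`) gives `σ ≤ ‖T‖` — test `T` on the trial
vector `Z c = Σ_i c_i √q_i g_i`, whose Rayleigh quotient is `≥ ‖G c‖²/(cᵀGc) ≥ (cᵀGc)/(cᵀc)`.  Neither the symmetry
of `T` nor any dropped-weight bound is needed. [cite: HornJohnson2013, Thm 4.2.2] -/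
theorem le_norm_of_galerkin_witness (hT : ∀ x, ⟪x, T x⟫_ℝ = ⟪A x, 𝒦 (A x)⟫_ℝ) (h𝒦 : 𝒦.IsPositive)
    (hf : Orthonormal ℝ f) (hq : ∀ i, 𝒦 (f i) = q i • f i)
    (hg : ∀ i x, ⟪g i, x⟫_ℝ = ⟪f i, A x⟫_ℝ) (hG : ∀ i j, G i j = √(q i) * √(q j) * ⟪g i, g j⟫_ℝ)
    {σ : ℝ} {c : ι → ℝ} (hc : 0 < c ⬝ᵥ c) (hσ : σ * (c ⬝ᵥ c) ≤ c ⬝ᵥ (G *ᵥ c)) : σ ≤ ‖T‖ := by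
  have hq0 : ∀ i, 0 ≤ q i := kept_weight_nonneg 𝒦 h𝒦 hf hq
  by_cases hGc : c ⬝ᵥ (G *ᵥ c) ≤ 0
  · -- then `σ ≤ 0 ≤ ‖T‖`
    have hσ0 : σ ≤ 0 := by
      by_contra h
      exact absurd (lt_of_lt_of_le (mul_pos (lt_of_not_ge h) hc) hσ) (not_lt.mpr hGc)
    exact hσ0.trans (norm_nonneg _)
  rw [not_le] at hGc
  -- the trial vector
  set x : E := ∑ i, (c i * √(q i)) • g i with hx
  have hxx : ‖x‖ ^ 2 = c ⬝ᵥ (G *ᵥ c) := norm_sq_trial hG c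
  have hx2 : 0 < ‖x‖ ^ 2 := by rw [hxx]; exact hGc
  -- its kept form is `‖G c‖²`
  have hkept : ∑ i, q i * ⟪f i, A x⟫_ℝ ^ 2 = (G *ᵥ c) ⬝ᵥ (G *ᵥ c) := by
    rw [keptForm_eq_sum_sq hq0 x, dotProduct]
    refine Finset.sum_congr rfl fun i _ => ?_
    rw [hx, keptCoeff_trial hg hG c i, sq]
  -- Cauchy–Schwarz in `ℝ^ι`: `(cᵀGc)² ≤ (cᵀc)·‖Gc‖²`
  have hCS : (c ⬝ᵥ (G *ᵥ c)) * (c ⬝ᵥ (G *ᵥ c)) ≤ (c ⬝ᵥ c) * ((G *ᵥ c) ⬝ᵥ (G *ᵥ c)) := by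
    have h := real_inner_mul_inner_self_le (toLp 2 c : EuclideanSpace ℝ ι) (toLp 2 (G *ᵥ c))
    simp only [EuclideanSpace.inner_toLp_toLp, star_trivial, dotProduct_comm (G *ᵥ c) c] at h
    exact h
  -- the Rayleigh quotient of `T` at `x`
  have hR : ⟪T x, x⟫_ℝ ≤ ‖T‖ * ‖x‖ ^ 2 := inner_apply_le_norm_mul_sq x
  have hTx : (G *ᵥ c) ⬝ᵥ (G *ᵥ c) ≤ ⟪T x, x⟫_ℝ := by
    rw [real_inner_comm, hT, ← hkept]
    exact sum_le_inner_kinetic 𝒦 h𝒦 hf hq (A x)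
  -- assemble: `σ (cᵀc) (cᵀGc) ≤ (cᵀGc)² ≤ (cᵀc) ‖Gc‖² ≤ (cᵀc) ‖T‖ (cᵀGc)`
  have h1 : σ * (c ⬝ᵥ c) * (c ⬝ᵥ (G *ᵥ c)) ≤ (c ⬝ᵥ c) * (‖T‖ * (c ⬝ᵥ (G *ᵥ c))) := by
    calc σ * (c ⬝ᵥ c) * (c ⬝ᵥ (G *ᵥ c)) ≤ (c ⬝ᵥ (G *ᵥ c)) * (c ⬝ᵥ (G *ᵥ c)) :=
          mul_le_mul_of_nonneg_right hσ hGc.le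
      _ ≤ (c ⬝ᵥ c) * ((G *ᵥ c) ⬝ᵥ (G *ᵥ c)) := hCS
      _ ≤ (c ⬝ᵥ c) * (‖T‖ * ‖x‖ ^ 2) := mul_le_mul_of_nonneg_left (hTx.trans hR) hc.le
      _ = (c ⬝ᵥ c) * (‖T‖ * (c ⬝ᵥ (G *ᵥ c))) := by rw [hxx]
  have h2 : σ * ((c ⬝ᵥ c) * (c ⬝ᵥ (G *ᵥ c))) ≤ ‖T‖ * ((c ⬝ᵥ c) * (c ⬝ᵥ (G *ᵥ c))) := by
    calc σ * ((c ⬝ᵥ c) * (c ⬝ᵥ (G *ᵥ c))) = σ * (c ⬝ᵥ c) * (c ⬝ᵥ (G *ᵥ c)) := by ring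
      _ ≤ (c ⬝ᵥ c) * (‖T‖ * (c ⬝ᵥ (G *ᵥ c))) := h1
      _ = ‖T‖ * ((c ⬝ᵥ c) * (c ⬝ᵥ (G *ᵥ c))) := by ring
  exact le_of_mul_le_mul_right h2 (mul_pos hc hGc)

end Certificate

end KWeightTailOperator

end Summit.Ventures.YMGap.FlowData
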